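import Mathlib
import HarnessLib

/-!
# The rate constants of the core piece of `stub_hODpot_A` (scalar algebra)

Support file for the crux `NearFlatRatioLaw` (line `ratepack_v2`, stub `stub_hODpot_A`; successor step (C) of
`Cruxes/NearFlatRatioLaw/Lines/ratepack-v7-moments-g18.md` §14; memo v8 (g19)).

`…CoreCurrencyPot.core_currency_pot` prices the core piece as `Λ²(c_T·T + c_κ·γ∫od²φ²)` with
`c_T = [16GX_φ/((1−κ_P)(1−η)) + (64η² + 16κ_P²)/((1−κ_P)(1−η)²)]/(1−κ_n)`, `c_κ = 16GX_ψ/((1−κ_P)(1−η))`, `G = 40(1+η)ΞCr`, `X_φ = C_φ·w`,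
`X_ψ = C_ψ`, `κ_n = 1/2`.  Once `η, κ_P ≤ 1/2` and `κ_P² ≤ C_p²K_c⁴·w` (`w = β^{-2/3}`; `κ_P = C_p(K_cβ^{-1/6})²`):
★ `core_rate_consts_le` — `c_T·T + c_κ·(γψ) ≤ (7680ΞCrC_φ + 256C_p²K_c⁴ + 1024)·(η² + w)·T + 3840ΞCrC_ψ·(γψ)` — β-INDEPENDENT constants, the
`b_A² = O(η² + β^{-2/3})`, `κ_A = O(1)` of the stub.  Pure real algebra.
-/

noncomputable section

namespace Summit.QuantumFields.YangMills.Theorems.FemtoTransferGap.TwoLattice.ConstTube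

/-- ★ **The rate constants** (see the module docstring). [folklore] -/
theorem core_rate_consts_le {η κP Ξ Cr Cφ Cψ w Cp Kc T γψ : ℝ} (hη0 : 0 ≤ η) (hη : η ≤ 1 / 2) (hκP : κP ≤ 1 / 2)
    (hΞ : 0 ≤ Ξ) (hCr : 0 ≤ Cr) (hCφ : 0 ≤ Cφ) (hCψ : 0 ≤ Cψ) (hw : 0 ≤ w) (hκPw : κP ^ 2 ≤ Cp ^ 2 * Kc ^ 4 * w) (hT : 0 ≤ T) (hγψ : 0 ≤ γψ) :
    ((16 * (40 * (1 + η) * Ξ * Cr) * (Cφ * w) / ((1 - κP) * (1 - η)) + (64 * η ^ 2 + 16 * κP ^ 2) / ((1 - κP) * (1 - η) ^ 2)) / (1 - 1 / 2)) * T +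
        (16 * (40 * (1 + η) * Ξ * Cr) * Cψ / ((1 - κP) * (1 - η))) * γψ ≤
      (7680 * Ξ * Cr * Cφ + 256 * Cp ^ 2 * Kc ^ 4 + 1024) * (η ^ 2 + w) * T + (3840 * Ξ * Cr * Cψ) * γψ := by
  have hη1 : 1 / 2 ≤ 1 - η := by linarith
  have hκ1 : 1 / 2 ≤ 1 - κP := by linarith
  have hd1 : 1 / 4 ≤ (1 - κP) * (1 - η) := by nlinarith
  have hd2 : 1 / 8 ≤ (1 - κP) * (1 - η) ^ 2 := by nlinarith
  have hd1p : 0 < (1 - κP) * (1 - η) := by linarith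
  have hd2p : 0 < (1 - κP) * (1 - η) ^ 2 := by linarith
  have hG : 0 ≤ 40 * (1 + η) * Ξ * Cr := by positivity
  have hG' : 40 * (1 + η) * Ξ * Cr ≤ 60 * Ξ * Cr := by nlinarith [mul_nonneg hΞ hCr]
  -- the three fractions
  have f1 : 16 * (40 * (1 + η) * Ξ * Cr) * (Cφ * w) / ((1 - κP) * (1 - η)) ≤ 3840 * Ξ * Cr * Cφ * w := by
    rw [div_le_iff₀ hd1p]
    have hx : 0 ≤ 16 * (40 * (1 + η) * Ξ * Cr) * (Cφ * w) := by positivity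
    have h1 : 16 * (40 * (1 + η) * Ξ * Cr) * (Cφ * w) ≤ 16 * (60 * Ξ * Cr) * (Cφ * w) :=
      mul_le_mul_of_nonneg_right (mul_le_mul_of_nonneg_left hG' (by norm_num)) (by positivity)
    nlinarith [mul_le_mul_of_nonneg_left hd1 (by positivity : (0 : ℝ) ≤ 3840 * Ξ * Cr * Cφ * w)]
  have f2 : (64 * η ^ 2 + 16 * κP ^ 2) / ((1 - κP) * (1 - η) ^ 2) ≤ 512 * η ^ 2 + 128 * (Cp ^ 2 * Kc ^ 4 * w) := by
    rw [div_le_iff₀ hd2p]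
    have hx : 0 ≤ 512 * η ^ 2 + 128 * (Cp ^ 2 * Kc ^ 4 * w) := by
      have := (sq_nonneg κP).trans hκPw; positivity
    nlinarith [mul_le_mul_of_nonneg_left hd2 hx, sq_nonneg η]
  have f3 : 16 * (40 * (1 + η) * Ξ * Cr) * Cψ / ((1 - κP) * (1 - η)) ≤ 3840 * Ξ * Cr * Cψ := by
    rw [div_le_iff₀ hd1p]
    have h1 : 16 * (40 * (1 + η) * Ξ * Cr) * Cψ ≤ 16 * (60 * Ξ * Cr) * Cψ :=
      mul_le_mul_of_nonneg_right (mul_le_mul_of_nonneg_left hG' (by norm_num)) hCψ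
    nlinarith [mul_le_mul_of_nonneg_left hd1 (by positivity : (0 : ℝ) ≤ 3840 * Ξ * Cr * Cψ)]
  have hsum : (16 * (40 * (1 + η) * Ξ * Cr) * (Cφ * w) / ((1 - κP) * (1 - η)) + (64 * η ^ 2 + 16 * κP ^ 2) / ((1 - κP) * (1 - η) ^ 2)) / (1 - 1 / 2) ≤
      (7680 * Ξ * Cr * Cφ + 256 * Cp ^ 2 * Kc ^ 4 + 1024) * (η ^ 2 + w) := by
    rw [show (1 - 1 / 2 : ℝ) = 1 / 2 by norm_num, div_le_iff₀ (by norm_num : (0 : ℝ) < 1 / 2)]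
    have hCK : 0 ≤ Cp ^ 2 * Kc ^ 4 := by positivity
    have hpos : 0 ≤ 7680 * Ξ * Cr * Cφ * η ^ 2 + 1024 * w + 256 * (Cp ^ 2 * Kc ^ 4) * η ^ 2 := by positivity
    nlinarith [f1, f2]
  have t1 := mul_le_mul_of_nonneg_right hsum hT
  have t2 := mul_le_mul_of_nonneg_right f3 hγψ
  linarith

end Summit.QuantumFields.YangMills.Theorems.FemtoTransferGap.TwoLattice.ConstTube

end
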